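import Summits.SmoothPoincare4.SmoothPoincare4.Theorems.ConvexBisectionAcyclicBisectionExistsCrossingNumberOrientation
import Summits.SmoothPoincare4.SmoothPoincare4.Theorems.ConvexBisectionAcyclicBisectionExistsSeamTwistSignWind
import HarnessLib

/-!
# Seam transport, ST4 (4a, pointwise): the page-frame relation of a page-preserving linear map and
# the winding step with pointwise coefficients
(wave 5, brick X3-1 of sub-node ST4 `node_ST4_twistSign` of node T3c-2 `node_seam_transport` of
stub `stub_T3_dualPresentation` (T3), line `modp-braid-orbits`, crux
`ConvexBisection.AcyclicBisectionExists`, item stmt-SmoothPoincare4-10508; registered sub-goal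
`helper_wind_pointwiseFrame`)

The twisting loop of a framing `ν` of a page curve `K` is `ℓ = (⟪V, iT⟫, ⟪V, n⟫)` (`T = K'` the
ambient velocity, a non-zero vector of the complex tangent line `L = ker dΦ` of the page,
`V = ν` read in `ℝ⁴ = ℂ²`, `n = horizNormal` the horizontal normal; `LefschetzBasePages.lean` §6).
For a real-linear map `Λ` of `ℝ⁴` (the ambient differential of a page-preserving boundary map at a
flat page point) the transported pair is `ℓ̃ = (⟪ΛV, iΛT⟫, ⟪ΛV, ñ⟫)`.  This file proves:

* §1 complex multiples `z · X = mk (z x_X) (z y_X)` in `ℂ² = ℝ⁴`: a vector of `L = ker dΦ_q` is a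
  complex multiple of any non-zero `T ∈ L` (`eq_mk_mul_of_dPhi_eq_zero`), with imaginary coefficient
  `⟪V, iT⟫ / ‖T‖²`;
* §2 **the frame relation** (`inner_cplxJ_map_of_mem_line`): if `V ∈ L` (in the application: the
  framing vector is a page tangent exactly where `ℓ₂ = ⟪V, n⟫ = 0`) then
  `⟪ΛV, iΛT⟫ = (⟪Λ(iT), iΛT⟫ / ‖T‖²) · ⟪V, iT⟫` — the in-page block of the upper-triangular matrix,
  with diagonal entry the PAGE DETERMINANT `b = ⟪Λ(iT), iΛT⟫ / ‖T‖²` of `Λ|L`; and `b ≠ 0` as soon as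
  `Λ` is injective on `L` and maps `L` into a complex line (`inner_cplxJ_map_ne_zero`);
* §3 **the winding step with POINTWISE coefficients** (`wind_eq_of_pointwise_frame`, registered as
  `helper_wind_pointwiseFrame`): if two loops `ℓ`, `ℓ̃` (continuous, closing up on `[0, 1]`, `ℓ`
  non-vanishing) satisfy `ℓ̃₂ = κ(t) ℓ₂` with `κ(t) > 0` and, wherever `ℓ₂ = 0`, `ℓ̃₁ = b(t) ℓ₁` with
  `σ b(t) > 0` (`σ = ±1` fixed), then `wind ℓ̃ = σ · wind ℓ` — the straight-line homotopy to
  `(σ ℓ₁, ℓ₂)` never vanishes; no continuity of `κ`, `b` is needed (this is the form in which the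
  ST4 assembly uses the landed `helper_wind_upperTriangular` idea: the page determinant along the
  knot is only known pointwise, its sign being pinned globally).

Everything is proved; no named facts, no `sorry`.  References: J. B. Etnyre, T. Fuller, IMRN 2006,
Thm. 1 (proof, p. 8) [EtnyreFuller2006]; W. Fulton, *Algebraic Topology: A First Course* (1995),
§3 (homotopy invariance of winding numbers) [Fulton1995].
-/

noncomputable section

set_option linter.dupNamespace false

open scoped ComplexConjugate
open Set Function Complex
open Literature.Topology.FourManifolds Literature.Topology.FourManifolds.LefschetzBase
  Literature.Topology.PlaneTopology

namespace Summit.SmoothPoincare4.SmoothPoincare4.Theorems.AcyclicBisectionExists.ModpBraidOrbits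

variable {g : ℕ}

/-! ## §1 Complex multiples in `ℂ² = ℝ⁴` -/

/-- A complex multiple is a real combination of `X` and `iX`: `z · X = (Re z) X + (Im z) iX`.
[folklore] -/
theorem mk_mul_eq_add_smul (z : ℂ) (X : EuclideanSpace ℝ (Fin 4)) :
    LefschetzBase.mk (z * cx X) (z * cy X) = z.re • X + z.im • cplxJ X := by
  apply ext_cx_cy
  · rw [cx_mk, cx_add, cx_smul, cx_smul, cx_cplxJ]
    conv_lhs => rw [← Complex.re_add_im z]
    ring
  · rw [cy_mk, cy_add, cy_smul, cy_smul, cy_cplxJ]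
    conv_lhs => rw [← Complex.re_add_im z]
    ring

/-- `⟪z · T, iT⟫ = Im z · ‖T‖²`. [folklore] -/
theorem inner_mk_mul_cplxJ (z : ℂ) (T : EuclideanSpace ℝ (Fin 4)) :
    inner ℝ (LefschetzBase.mk (z * cx T) (z * cy T)) (cplxJ T) = z.im * ‖T‖ ^ 2 := by
  rw [inner_cplxJ, cx_mk, cy_mk]
  have e : z * cx T * conj (cx T) + z * cy T * conj (cy T) = z * ((‖T‖ ^ 2 : ℝ) : ℂ) := by
    rw [ofReal_norm_sq_eq]; ring
  rw [e, Complex.mul_im, Complex.ofReal_re, Complex.ofReal_im, mul_zero, zero_add]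

/-- **A vector of the complex line through `T` is a complex multiple of `T`.**  If `T ≠ 0` and `V`
both lie in `L = ker dΦ_q` (`a x + b y = 0`, `(a, b) ≠ 0`), then `V = z · T` with
`z = ⟨V, T⟩_Herm / ‖T‖²`. [folklore] -/
theorem eq_mk_mul_of_dPhi_eq_zero {q V T : EuclideanSpace ℝ (Fin 4)} (hq : q ≠ 0) (hT : T ≠ 0)
    (hTL : dPhiX g q * cx T + dPhiY q * cy T = 0) (hVL : dPhiX g q * cx V + dPhiY q * cy V = 0) :
    V = LefschetzBase.mk ((cx V * conj (cx T) + cy V * conj (cy T)) / ((‖T‖ ^ 2 : ℝ) : ℂ) * cx T)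
      ((cx V * conj (cx T) + cy V * conj (cy T)) / ((‖T‖ ^ 2 : ℝ) : ℂ) * cy T) := by
  -- the `2 × 2` determinant vanishes
  have hdet : cx V * cy T - cx T * cy V = 0 := by
    rcases dPhiX_ne_zero_or (g := g) hq with ha | hb
    · have : dPhiX g q * (cx V * cy T - cx T * cy V) = dPhiX g q * 0 := by
        linear_combination (cy T) * hVL - (cy V) * hTL
      exact mul_left_cancel₀ ha this
    · have : dPhiY q * (cx V * cy T - cx T * cy V) = dPhiY q * 0 := by
        linear_combination (cx V) * hTL - (cx T) * hVL
      exact mul_left_cancel₀ hb this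
  set H : ℂ := cx V * conj (cx T) + cy V * conj (cy T) with hH
  have hm : (0 : ℝ) < ‖T‖ ^ 2 := by positivity
  have hmC := ofReal_norm_sq_eq T
  have hm0 : ((‖T‖ ^ 2 : ℝ) : ℂ) ≠ 0 := by exact_mod_cast hm.ne'
  have hx : ((‖T‖ ^ 2 : ℝ) : ℂ) * cx V = H * cx T := by
    rw [hmC, hH]; linear_combination (conj (cy T)) * hdet
  have hy : ((‖T‖ ^ 2 : ℝ) : ℂ) * cy V = H * cy T := by
    rw [hmC, hH]; linear_combination (-(conj (cx T))) * hdet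
  apply ext_cx_cy
  · rw [cx_mk]; field_simp; linear_combination hx
  · rw [cy_mk]; field_simp; linear_combination hy

/-- The imaginary part of the coefficient: if `V = z · T` as above then `Im z = ⟪V, iT⟫ / ‖T‖²`.
[folklore] -/
theorem im_herm_div_norm_sq (V T : EuclideanSpace ℝ (Fin 4)) :
    ((cx V * conj (cx T) + cy V * conj (cy T)) / ((‖T‖ ^ 2 : ℝ) : ℂ)).im =
      inner ℝ V (cplxJ T) / ‖T‖ ^ 2 := by
  rw [Complex.div_ofReal_im, inner_cplxJ]

/-! ## §2 The frame relation of a linear map on a complex line -/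

/-- **The in-page block of the frame relation.**  Let `Λ` be a real-linear map of `ℝ⁴` and let
`T ≠ 0`, `V` lie in the complex line `L = ker dΦ_q`.  Then
`⟪ΛV, iΛT⟫ = (⟪Λ(iT), iΛT⟫ / ‖T‖²) · ⟪V, iT⟫`: writing `V = (Re z) T + (Im z) iT`, the `T`-component
pairs to zero against `iΛT` (`⟪X, iX⟫ = 0`) and `Im z = ⟪V, iT⟫ / ‖T‖²`. [cite: EtnyreFuller2006, Thm. 1 (proof, p. 8)] -/
theorem inner_cplxJ_map_of_mem_line (Λ : EuclideanSpace ℝ (Fin 4) →ₗ[ℝ] EuclideanSpace ℝ (Fin 4))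
    {q V T : EuclideanSpace ℝ (Fin 4)} (hq : q ≠ 0) (hT : T ≠ 0)
    (hTL : dPhiX g q * cx T + dPhiY q * cy T = 0) (hVL : dPhiX g q * cx V + dPhiY q * cy V = 0) :
    inner ℝ (Λ V) (cplxJ (Λ T)) =
      inner ℝ (Λ (cplxJ T)) (cplxJ (Λ T)) / ‖T‖ ^ 2 * inner ℝ V (cplxJ T) := by
  set z : ℂ := (cx V * conj (cx T) + cy V * conj (cy T)) / ((‖T‖ ^ 2 : ℝ) : ℂ) with hz
  have hV : V = z.re • T + z.im • cplxJ T := by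
    rw [← mk_mul_eq_add_smul]; exact eq_mk_mul_of_dPhi_eq_zero hq hT hTL hVL
  have him : z.im = inner ℝ V (cplxJ T) / ‖T‖ ^ 2 := im_herm_div_norm_sq V T
  conv_lhs => rw [hV]
  rw [map_add, map_smul, map_smul, inner_add_smul_cplxJ, him]
  have hm : (‖T‖ ^ 2 : ℝ) ≠ 0 := by positivity
  field_simp

/-- **The page determinant of an injective line-to-line map does not vanish.**  If `Λ` is injective
on the complex line `L = ker dΦ_q ∋ T ≠ 0` and maps `T`, `iT` into a common complex line
`L' = ker dΦ_{q'}`, then `⟪Λ(iT), iΛT⟫ ≠ 0`: `Λ(iT) = z · ΛT` with `Im z ≠ 0` by injectivity.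
[folklore] -/
theorem inner_cplxJ_map_ne_zero (Λ : EuclideanSpace ℝ (Fin 4) →ₗ[ℝ] EuclideanSpace ℝ (Fin 4))
    {q q' T : EuclideanSpace ℝ (Fin 4)} (hq' : q' ≠ 0) (hT : T ≠ 0)
    (hTL : dPhiX g q * cx T + dPhiY q * cy T = 0)
    (hinj : ∀ X, dPhiX g q * cx X + dPhiY q * cy X = 0 → Λ X = 0 → X = 0)
    (hT' : dPhiX g q' * cx (Λ T) + dPhiY q' * cy (Λ T) = 0)
    (hiT' : dPhiX g q' * cx (Λ (cplxJ T)) + dPhiY q' * cy (Λ (cplxJ T)) = 0) :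
    inner ℝ (Λ (cplxJ T)) (cplxJ (Λ T)) ≠ 0 := by
  have hiTL : dPhiX g q * cx (cplxJ T) + dPhiY q * cy (cplxJ T) = 0 := by
    rw [cx_cplxJ, cy_cplxJ]; linear_combination Complex.I * hTL
  have hΛT : Λ T ≠ 0 := fun h0 => hT (hinj T hTL h0)
  set z : ℂ := (cx (Λ (cplxJ T)) * conj (cx (Λ T)) + cy (Λ (cplxJ T)) * conj (cy (Λ T))) /
    ((‖Λ T‖ ^ 2 : ℝ) : ℂ) with hz
  have hrep : Λ (cplxJ T) = LefschetzBase.mk (z * cx (Λ T)) (z * cy (Λ T)) :=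
    eq_mk_mul_of_dPhi_eq_zero hq' hΛT hT' hiT'
  rw [hrep, inner_mk_mul_cplxJ]
  intro h0
  have hn : (0 : ℝ) < ‖Λ T‖ ^ 2 := by positivity
  have hzim : z.im = 0 := by
    rcases mul_eq_zero.1 h0 with h | h
    · exact h
    · exact absurd h hn.ne'
  -- then `Λ (iT - Re z • T) = 0`, so `iT = Re z • T`, contradicting `⟪iT, iT⟫ = ‖T‖² ≠ 0`
  have hker : Λ (cplxJ T - z.re • T) = 0 := by
    rw [map_sub, map_smul, hrep, mk_mul_eq_add_smul, hzim, zero_smul, add_zero, sub_self]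
  have hline : dPhiX g q * cx (cplxJ T - z.re • T) + dPhiY q * cy (cplxJ T - z.re • T) = 0 := by
    rw [sub_eq_add_neg, cx_add, cy_add, ← neg_smul, cx_smul, cy_smul]
    linear_combination hiTL + (-z.re : ℝ) * hTL
  have heq : cplxJ T = z.re • T := sub_eq_zero.1 (hinj _ hline hker)
  have h1 : inner ℝ (cplxJ T) (cplxJ T) = 0 := by
    conv_lhs => arg 2; rw [heq]
    rw [real_inner_smul_left, inner_cplxJ_self, mul_zero]
  have hI : LefschetzBase.mk (Complex.I * cx T) (Complex.I * cy T) = cplxJ T := by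
    apply ext_cx_cy
    · rw [cx_mk, cx_cplxJ]
    · rw [cy_mk, cy_cplxJ]
  have h2 : inner ℝ (cplxJ T) (cplxJ T) = ‖T‖ ^ 2 := by
    have := inner_mk_mul_cplxJ Complex.I T
    rw [hI, Complex.I_im, one_mul] at this
    exact this
  have hT2 : (0 : ℝ) < ‖T‖ ^ 2 := by positivity
  linarith

/-! ## §3 The winding step with pointwise coefficients -/

/-- Stage `s` of the straight-line homotopy from `ℓ'` to `(σ ℓ₁, ℓ₂)` does not vanish at a
parameter where `ℓ'₂ = κ ℓ₂` (`κ > 0`), `ℓ ≠ 0`, and `ℓ₂ = 0 ⇒ ℓ'₁ = b ℓ₁` with `σ b > 0`.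
[cite: Fulton1995, §3] -/
theorem pointwiseFrame_homotopy_ne_zero {x x' : ℂ} {σ : ℤ} (hσ : σ = 1 ∨ σ = -1) (hx : x ≠ 0)
    (him : ∃ κ : ℝ, 0 < κ ∧ x'.im = κ * x.im)
    (hre : x.im = 0 → ∃ b : ℝ, 0 < (σ : ℝ) * b ∧ x'.re = b * x.re) {s : ℝ} (hs : s ∈ Icc (0 : ℝ) 1) :
    ((1 - s : ℝ) : ℂ) * x' + (s : ℂ) * (⟨σ * x.re, x.im⟩ : ℂ) ≠ 0 := by
  obtain ⟨κ, hκ, hκe⟩ := him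
  intro h0
  have h2 : ((1 - s) * κ + s) * x.im = 0 := by
    have := congrArg Complex.im h0
    simp only [Complex.add_im, Complex.im_ofReal_mul, Complex.zero_im, hκe] at this
    linear_combination this
  have hc2 : 0 < (1 - s) * κ + s := by
    rcases eq_or_lt_of_le hs.2 with h | h
    · rw [h]; norm_num
    · nlinarith [hs.1, hκ]
  have hxim : x.im = 0 := (mul_eq_zero.1 h2).resolve_left hc2.ne'
  obtain ⟨b, hb, hbe⟩ := hre hxim
  have h1 : ((1 - s) * b + s * σ) * x.re = 0 := by
    have := congrArg Complex.re h0
    simp only [Complex.add_re, Complex.re_ofReal_mul, Complex.zero_re, hbe] at this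
    linear_combination this
  have hc1 : 0 < (σ : ℝ) * ((1 - s) * b + s * σ) := by
    have hσ2 : (σ : ℝ) * σ = 1 := by rcases hσ with h | h <;> simp [h]
    have e : (σ : ℝ) * ((1 - s) * b + s * σ) = (1 - s) * (σ * b) + s := by
      linear_combination s * hσ2
    rw [e]
    rcases eq_or_lt_of_le hs.2 with h | h
    · rw [h]; norm_num
    · nlinarith [hs.1, hb]
  have hxre : x.re = 0 := by
    rcases mul_eq_zero.1 h1 with h | h
    · exfalso; rw [h, mul_zero] at hc1; exact lt_irrefl _ hc1
    · exact h
  exact hx (Complex.ext hxre hxim)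

/-- **The winding step with pointwise coefficients.**  Let `ℓ`, `ℓ'` be continuous loops closing up
on `[0, 1]`, `ℓ` non-vanishing, `σ = ±1`.  If `ℓ'₂ = κ(t) ℓ₂` with `κ(t) > 0` for every
`t ∈ [0, 1]`, and `ℓ₂(t) = 0 ⇒ ℓ'₁(t) = b(t) ℓ₁(t)` with `σ b(t) > 0`, then `wind ℓ' = σ · wind ℓ`:
the straight-line homotopy from `ℓ'` to `(σ ℓ₁, ℓ₂)` never vanishes
(`pointwiseFrame_homotopy_ne_zero`), and `wind (σ ℓ₁, ℓ₂) = σ wind ℓ` (`wind_neg`, `wind_conj`).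
[cite: Fulton1995, §3] -/
theorem wind_eq_of_pointwise_frame {ℓ ℓ' : ℝ → ℂ} {σ : ℤ} (hℓc : Continuous ℓ) (hℓ'c : Continuous ℓ')
    (h01 : ℓ 0 = ℓ 1) (h01' : ℓ' 0 = ℓ' 1) (hne : ∀ t, ℓ t ≠ 0) (hσ : σ = 1 ∨ σ = -1)
    (him : ∀ t ∈ Icc (0 : ℝ) 1, ∃ κ : ℝ, 0 < κ ∧ (ℓ' t).im = κ * (ℓ t).im)
    (hre : ∀ t ∈ Icc (0 : ℝ) 1, (ℓ t).im = 0 → ∃ b : ℝ, 0 < (σ : ℝ) * b ∧ (ℓ' t).re = b * (ℓ t).re) :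
    wind ℓ' = σ * wind ℓ := by
  let H : ℝ → ℝ → ℂ := fun s t => ((1 - s : ℝ) : ℂ) * ℓ' t + (s : ℂ) * (⟨σ * (ℓ t).re, (ℓ t).im⟩ : ℂ)
  have hEc : Continuous fun t => (⟨σ * (ℓ t).re, (ℓ t).im⟩ : ℂ) := by
    have h1 : Continuous fun t => (σ : ℝ) * (ℓ t).re := continuous_const.mul (Complex.continuous_re.comp hℓc)
    have h2 : Continuous fun t => (ℓ t).im := Complex.continuous_im.comp hℓc
    exact Complex.equivRealProdCLM.symm.continuous.comp (h1.prodMk h2)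
  have hHc : ContinuousOn (uncurry H) (Icc 0 1 ×ˢ Icc 0 1) := by
    refine Continuous.continuousOn ?_
    exact ((Complex.continuous_ofReal.comp (continuous_const.sub continuous_fst)).mul
      (hℓ'c.comp continuous_snd)).add
      ((Complex.continuous_ofReal.comp continuous_fst).mul (hEc.comp continuous_snd))
  have hloop : ∀ s ∈ Icc (0 : ℝ) 1, H s 0 = H s 1 := fun s _ => by
    simp only [H, h01, h01']
  have hHne : ∀ s ∈ Icc (0 : ℝ) 1, ∀ t ∈ Icc (0 : ℝ) 1, H s t ≠ 0 := fun s hs t ht =>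
    pointwiseFrame_homotopy_ne_zero hσ (hne t) (him t ht) (hre t ht) hs
  have hwind := wind_eq_of_homotopy hHc hloop hHne
  have e0 : H 0 = ℓ' := by funext t; simp [H]
  rw [e0] at hwind
  rw [hwind]
  have hnl : IsNonvanishingLoop ℓ := ⟨hℓc.continuousOn, fun t _ => hne t, h01⟩
  rcases hσ with h | h
  · subst h
    have e1 : H 1 = ℓ := by
      funext t; apply Complex.ext <;> simp [H]
    rw [e1]; simp
  · subst h
    have e1 : H 1 = fun t => -conj (ℓ t) := by
      funext t; apply Complex.ext <;> simp [H]
    have hconj : IsNonvanishingLoop fun t => conj (ℓ t) :=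
      ⟨(Complex.continuous_conj.comp hℓc).continuousOn, fun t _ => (map_ne_zero _).2 (hne t),
        by simp only [h01]⟩
    rw [e1, wind_neg hconj, wind_conj hnl]
    simp

/-- **Sub-goal `helper_wind_pointwiseFrame` of stub `stub_T3_dualPresentation`** (T3 ▸ T3c-2 ▸ ST4
`node_ST4_twistSign`, brick X3-1 (4a, pointwise winding step); wave 5, lead c5): for continuous loops
`ℓ`, `ℓ'` closing up on `[0, 1]`, `ℓ` non-vanishing, `σ = ±1`, with `ℓ'₂ = κ(t) ℓ₂` (`κ(t) > 0`) on
`[0, 1]` and `ℓ₂ = 0 ⇒ ℓ'₁ = b(t) ℓ₁`, `σ b(t) > 0` (coefficients only POINTWISE, no continuity),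
`wind ℓ' = σ · wind ℓ`. [cite: Fulton1995, §3] -/
theorem helper_wind_pointwiseFrame : ∀ (ℓ ℓ' : ℝ → ℂ) (σ : ℤ), Continuous ℓ → Continuous ℓ' → ℓ 0 = ℓ 1 → ℓ' 0 = ℓ' 1 → (∀ t, ℓ t ≠ 0) → (σ = 1 ∨ σ = -1) → (∀ t ∈ Set.Icc (0 : ℝ) 1, ∃ κ : ℝ, 0 < κ ∧ (ℓ' t).im = κ * (ℓ t).im) → (∀ t ∈ Set.Icc (0 : ℝ) 1, (ℓ t).im = 0 → ∃ b : ℝ, 0 < (σ : ℝ) * b ∧ (ℓ' t).re = b * (ℓ t).re) → Literature.Topology.PlaneTopology.wind ℓ' = σ * Literature.Topology.PlaneTopology.wind ℓ :=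
  fun _ _ _ hℓc hℓ'c h01 h01' hne hσ him hre =>
    wind_eq_of_pointwise_frame hℓc hℓ'c h01 h01' hne hσ him hre

end Summit.SmoothPoincare4.SmoothPoincare4.Theorems.AcyclicBisectionExists.ModpBraidOrbits


end
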